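import Mathlib
import HarnessLib
import Summits.Ventures.LatticeQCDFlow.Exactness.SUNOmf2EnergyError

/-!
# `SU(N)` rung in general coordinates — THE ENERGY ERROR OF THE ENGINE'S `n`-STEP OMF2 PROPOSAL `flip ∘ (omf2Word g₁ (mulDrift e_δ) g₂)ⁿ` WITH THE CONSISTENT KICKS IS `O(nδ²)`, EXPLICITLY — momentum growth along the trajectory and the trajectory bound

HONEST FRAMING: exact (Metropolis-corrected) sampling algorithms for lattice gauge theory;
figures of merit are autocorrelation/cost numbers at stated couplings and volumes; no
continuum-physics claim.

Venture `LatticeQCDFlow` (cell pub-lqcd), topic `Exactness`; FANOUT row 14 (`eng-flowhmc`, engine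
`latflow.fthmc`, family B, `integrator = "omf2"`; the row's «acceptance vs step size» column for the OMF2 proposal on the
`SU(N)` rung of rows 21–26).  The general-coordinates twin of `SU2Omf2TrajectoryEnergyError`.  NEW WORK of the cell over
`SUNOmf2EnergyError` (one OMF2 step: the word read off, kicks bounded by `|c|D_max/κ`, `|ΔH₁| ≤ βK·A|δ|·P·((|1−2λ|+2|λ|+1)Σ + 4λ²|L|D_max/κ)`,
`A = N²C_ι`), `SUNExpDriftWork`, `SplittingWords` (`omf2Word`) and `SplittingIntegrator` (`flip`); the proposal is the one
typed exact / measure-preserving / reversible on the `SU(N)` rung by `Omf2ProposalLaws` §0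
(`(flip : Equiv.Perm _) * omf2Word g₁ (mulDrift (sunExpDrift ι hι δ)) g₂ ^ n`); nothing is cited as a fact; no number.
Setting and hypotheses exactly as in `SUNOmf2EnergyError` (coordinates `‖ι x‖ ≤ C_ι‖x‖`, symmetric pairing `B` with
`|B(x,y)| ≤ β‖x‖‖y‖`, represented force field `D` bounded by `D_max` and `K`-Lipschitz in the matrix sup norm, consistent
kicks `g₁ = −(λ/κ)D`, `g₂ = −((1−2λ)/κ)D`, kinetic term `κΣ_l B(p_l,p_l)`).

* `sunOmf2Step_iterate_snd_le` — momentum growth: after `k` steps `‖p_k‖ ≤ ‖p‖ + k·γ₂`, `Σ_l‖p_k,l‖ ≤ Σ_l‖p_l‖ + k|L|γ₂`,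
  `γ₂ = (2|λ| + |1−2λ|)D_max/κ`;
* **`abs_sunOmf2N_energy_error_le`** — for every `k ≤ n`:
  `|H(wᵏ(q,p)) − H(q,p)| ≤ k·βK·A|δ|·(‖p‖ + (n+1)γ₂)·((|1−2λ|+2|λ|+1)(Σ_l‖p_l‖ + (n+1)|L|γ₂) + 4λ²|L|D_max/κ)`;
* **`abs_sunOmf2ProposalN_energy_error_le`** — THE ENERGY ERROR OF THE ENGINE'S `n`-STEP OMF2 PROPOSAL, the quantity in
  its Metropolis test: the same bound with `k = n` — `O(nδ²) = O(τδ)` at fixed trajectory length once `K, D_max = O(δ)`;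
  the acceptance probability is `≥ exp(−that)` pointwise.

NOT CLAIMED: the mean acceptance under the refresh (compose with `SUNMomentumLawMoments` as in
`SUNLeapfrogMeanAcceptance`); OMF4; optimal constants; floating point; any number.
-/

noncomputable section

namespace Summit.Ventures.LatticeQCDFlow.Exactness

open Set Function NormedSpace
open scoped Matrix Matrix.Norms.Operator

set_option backward.isDefEq.respectTransparency false

variable {n : Type*} [Fintype n] [DecidableEq n]
variable {E : Type*} [NormedAddCommGroup E] [NormedSpace ℝ E]
variable (ι : E →ₗ[ℝ] Matrix n n ℂ) (hι : ∀ a, (ι a)ᴴ = -ι a ∧ (ι a).trace = 0)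
variable (B : E →ₗ[ℝ] E →ₗ[ℝ] ℝ)
variable {L : Type*} [Fintype L]

/-- **Momentum growth along the OMF2 trajectory**: after `k` steps the sup norm of the momentum has grown by at most
`k·(2|λ| + |1−2λ|)·D_max/κ`, and `Σ_l‖p_l‖` by at most `k·|L|·(2|λ| + |1−2λ|)·D_max/κ`. -/
theorem sunOmf2Step_iterate_snd_le (δ κ lam : ℝ) (hκ : 0 < κ) (D g₁ g₂ : (L → Matrix.specialUnitaryGroup n ℂ) → L → E)
    (hg₁ : ∀ W l, g₁ W l = -(lam / κ) • D W l) (hg₂ : ∀ W l, g₂ W l = -((1 - 2 * lam) / κ) • D W l)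
    {Dmax : ℝ} (hD0 : 0 ≤ Dmax) (hDb : ∀ (W : L → Matrix.specialUnitaryGroup n ℂ) (l : L), ‖D W l‖ ≤ Dmax)
    (q : L → Matrix.specialUnitaryGroup n ℂ) (p : L → E) (k : ℕ) :
    ‖((⇑(omf2Word g₁ (mulDrift (sunExpDrift ι hι δ)) g₂))^[k] (q, p)).2‖ ≤
        ‖p‖ + k * ((2 * |lam| + |1 - 2 * lam|) * (Dmax / κ)) ∧
      ∑ l, ‖((⇑(omf2Word g₁ (mulDrift (sunExpDrift ι hι δ)) g₂))^[k] (q, p)).2 l‖ ≤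
        ∑ l, ‖p l‖ + k * (Fintype.card L * ((2 * |lam| + |1 - 2 * lam|) * (Dmax / κ))) := by
  have hk₁ := norm_sunFracKick_le κ lam hκ D g₁ hg₁ hD0 hDb
  have hk₂ := norm_sunFracKick_le κ (1 - 2 * lam) hκ D g₂ hg₂ hD0 hDb
  have hk₁l := norm_sunFracKick_apply_le κ lam hκ D g₁ hg₁ hDb
  have hk₂l := norm_sunFracKick_apply_le κ (1 - 2 * lam) hκ D g₂ hg₂ hDb
  induction k with
  | zero => simp
  | succ k ih =>
    rw [Function.iterate_succ_apply']
    set z := (⇑(omf2Word g₁ (mulDrift (sunExpDrift ι hι δ)) g₂))^[k] (q, p) with hz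
    obtain ⟨ih1, ih2⟩ := ih
    have hstep := sunOmf2Step_apply ι hι g₁ g₂ δ z.1 z.2
    rw [Prod.mk.eta] at hstep
    rw [hstep]
    dsimp only
    constructor
    · refine ((norm_add_le _ _).trans (add_le_add ((norm_add_le _ _).trans (add_le_add ((norm_add_le _ _).trans
        (add_le_add ih1 (hk₁ _))) (hk₂ _))) (hk₁ _))).trans (le_of_eq ?_)
      push_cast; ring
    · calc _ ≤ ∑ l, (‖z.2 l‖ + |lam| * (Dmax / κ) + |1 - 2 * lam| * (Dmax / κ) + |lam| * (Dmax / κ)) := by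
            refine Finset.sum_le_sum fun l _ => ?_
            rw [Pi.add_apply, Pi.add_apply, Pi.add_apply]
            exact (norm_add_le _ _).trans (add_le_add ((norm_add_le _ _).trans (add_le_add ((norm_add_le _ _).trans
              (add_le_add le_rfl (hk₁l _ l))) (hk₂l _ l))) (hk₁l _ l))
        _ = ∑ l, ‖z.2 l‖ + Fintype.card L * ((2 * |lam| + |1 - 2 * lam|) * (Dmax / κ)) := by
            simp only [Finset.sum_add_distrib, Finset.sum_const, Finset.card_univ, nsmul_eq_mul]; ring
        _ ≤ _ := by push_cast; nlinarith [ih2]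

set_option maxHeartbeats 400000 in -- RN-23 (7)(b): heavy declaration budgeted at source (lake build ≈ 10 % hungrier than the gate)
/-- **THE ENERGY ERROR OF THE `n`-STEP OMF2 TRAJECTORY**: for every `k ≤ N`, with `A = N²C_ι`,
`γ₂ = (2|λ| + |1−2λ|)·D_max/κ`,
`|H(wᵏ(q,p)) − H(q,p)| ≤ k·βK·A|δ|·(‖p‖ + (N+1)γ₂)·((|1−2λ|+2|λ|+1)·(Σ_l‖p_l‖ + (N+1)|L|γ₂) + 4λ²|L|D_max/κ)`. -/
theorem abs_sunOmf2N_energy_error_le {Cι : ℝ} (hC0 : 0 ≤ Cι) (hCι : ∀ x : E, ‖ι x‖ ≤ Cι * ‖x‖)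
    (S : (L → Matrix.specialUnitaryGroup n ℂ) → ℝ) (δ κ lam : ℝ) (hκ : 0 < κ)
    (hd : ∀ W : L → Matrix.specialUnitaryGroup n ℂ, DifferentiableAt ℝ (fun a : L → E => S (sunExpDrift ι hι δ a * W)) 0)
    (hBs : ∀ x y : E, B x y = B y x) {β : ℝ} (hβ0 : 0 ≤ β) (hBβ : ∀ x y : E, |B x y| ≤ β * ‖x‖ * ‖y‖)
    (D g₁ g₂ : (L → Matrix.specialUnitaryGroup n ℂ) → L → E)
    (hD : ∀ (W : L → Matrix.specialUnitaryGroup n ℂ) (v : L → E),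
      fderiv ℝ (fun a : L → E => S (sunExpDrift ι hι δ a * W)) 0 v = ∑ l, B (D W l) (v l))
    {Dmax K : ℝ} (hD0 : 0 ≤ Dmax) (hK0 : 0 ≤ K)
    (hDb : ∀ (W : L → Matrix.specialUnitaryGroup n ℂ) (l : L), ‖D W l‖ ≤ Dmax)
    (hDK : ∀ W W' : L → Matrix.specialUnitaryGroup n ℂ, ‖D W - D W'‖ ≤ K * ‖coeConfig W - coeConfig W'‖)
    (hg₁ : ∀ W l, g₁ W l = -(lam / κ) • D W l) (hg₂ : ∀ W l, g₂ W l = -((1 - 2 * lam) / κ) • D W l)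
    (q : L → Matrix.specialUnitaryGroup n ℂ) (p : L → E) (N : ℕ) :
    ∀ k ≤ N, |(S ((⇑(omf2Word g₁ (mulDrift (sunExpDrift ι hι δ)) g₂))^[k] (q, p)).1 +
        κ * ∑ l, B (((⇑(omf2Word g₁ (mulDrift (sunExpDrift ι hι δ)) g₂))^[k] (q, p)).2 l)
          (((⇑(omf2Word g₁ (mulDrift (sunExpDrift ι hι δ)) g₂))^[k] (q, p)).2 l)) -
        (S q + κ * ∑ l, B (p l) (p l))| ≤
      k * (β * K * ((Fintype.card n : ℝ) ^ 2 * Cι) * |δ| * (‖p‖ + (N + 1) * ((2 * |lam| + |1 - 2 * lam|) * (Dmax / κ))) *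
        ((|1 - 2 * lam| + 2 * |lam| + 1) * (∑ l, ‖p l‖ + (N + 1) * (Fintype.card L * ((2 * |lam| + |1 - 2 * lam|) * (Dmax / κ)))) +
          4 * lam ^ 2 * (Fintype.card L * Dmax / κ))) := by
  set γ₂ : ℝ := (2 * |lam| + |1 - 2 * lam|) * (Dmax / κ) with hγ₂
  have hγ₂0 : 0 ≤ γ₂ := by rw [hγ₂]; positivity
  have hγle : (|lam| + |1 - 2 * lam|) * (Dmax / κ) ≤ γ₂ := by
    rw [hγ₂]; nlinarith [abs_nonneg lam, div_nonneg hD0 hκ.le]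
  set Bd := β * K * ((Fintype.card n : ℝ) ^ 2 * Cι) * |δ| * (‖p‖ + (N + 1) * γ₂) *
    ((|1 - 2 * lam| + 2 * |lam| + 1) * (∑ l, ‖p l‖ + (N + 1) * (Fintype.card L * γ₂)) + 4 * lam ^ 2 * (Fintype.card L * Dmax / κ))
    with hBd
  -- the phase-space energy and the step map
  set Hf : (L → Matrix.specialUnitaryGroup n ℂ) × (L → E) → ℝ := fun w => S w.1 + κ * ∑ l, B (w.2 l) (w.2 l) with hHf
  set Ψ : (L → Matrix.specialUnitaryGroup n ℂ) × (L → E) → (L → Matrix.specialUnitaryGroup n ℂ) × (L → E) :=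
    ⇑(omf2Word g₁ (mulDrift (sunExpDrift ι hι δ)) g₂) with hΨ
  -- one step from the k-th point of the trajectory costs at most Bd (k ≤ N)
  have hone : ∀ k, k ≤ N → |Hf (Ψ (Ψ^[k] (q, p))) - Hf (Ψ^[k] (q, p))| ≤ Bd := by
    intro k hk
    have hkN : (k : ℝ) ≤ N := by exact_mod_cast hk
    set z := Ψ^[k] (q, p) with hz
    obtain ⟨hz1, hz2⟩ := sunOmf2Step_iterate_snd_le ι hι δ κ lam hκ D g₁ g₂ hg₁ hg₂ hD0 hDb q p k
    rw [← hΨ, ← hz, ← hγ₂] at hz1 hz2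
    have hstep := abs_sunOmf2_energy_error_le ι hι B hC0 hCι S δ κ lam hκ hd hBs hβ0 hBβ D g₁ g₂ hD hD0 hK0 hDb hDK hg₁ hg₂ z.1 z.2
    have happ := sunOmf2Step_apply ι hι g₁ g₂ δ z.1 z.2
    rw [Prod.mk.eta] at happ
    have hval : Hf (Ψ z) - Hf z =
        (S (sunExpDrift ι hι δ ((z.2 + g₁ z.1) + g₂ (sunExpDrift ι hι δ (z.2 + g₁ z.1) * z.1)) * (sunExpDrift ι hι δ (z.2 + g₁ z.1) * z.1)) +
          κ * ∑ l, B ((((z.2 + g₁ z.1) + g₂ (sunExpDrift ι hι δ (z.2 + g₁ z.1) * z.1)) +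
              g₁ (sunExpDrift ι hι δ ((z.2 + g₁ z.1) + g₂ (sunExpDrift ι hι δ (z.2 + g₁ z.1) * z.1)) * (sunExpDrift ι hι δ (z.2 + g₁ z.1) * z.1))) l)
            ((((z.2 + g₁ z.1) + g₂ (sunExpDrift ι hι δ (z.2 + g₁ z.1) * z.1)) +
              g₁ (sunExpDrift ι hι δ ((z.2 + g₁ z.1) + g₂ (sunExpDrift ι hι δ (z.2 + g₁ z.1) * z.1)) * (sunExpDrift ι hι δ (z.2 + g₁ z.1) * z.1))) l)) -
        (S z.1 + κ * ∑ l, B (z.2 l) (z.2 l)) := by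
      rw [hHf, hΨ, happ]
    rw [hval]
    -- the one-step bound from z is at most Bd
    have hc : (0 : ℝ) ≤ Fintype.card L := Nat.cast_nonneg _
    have hkg : (k : ℝ) * γ₂ ≤ (N + 1) * γ₂ - γ₂ := by nlinarith [mul_nonneg (sub_nonneg.2 hkN) hγ₂0]
    have hcg : Fintype.card L * ((|lam| + |1 - 2 * lam|) * (Dmax / κ)) ≤ Fintype.card L * γ₂ :=
      mul_le_mul_of_nonneg_left hγle hc
    have hkg2 : (k : ℝ) * (Fintype.card L * γ₂) ≤ (N + 1) * (Fintype.card L * γ₂) - Fintype.card L * γ₂ := by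
      nlinarith [mul_nonneg (sub_nonneg.2 hkN) (mul_nonneg hc hγ₂0)]
    have hn1 : ‖z.2‖ + (|lam| + |1 - 2 * lam|) * (Dmax / κ) ≤ ‖p‖ + (N + 1) * γ₂ := by linarith [hz1, hγle, hkg]
    have hs1 : ∑ l, ‖z.2 l‖ + Fintype.card L * ((|lam| + |1 - 2 * lam|) * (Dmax / κ)) ≤
        ∑ l, ‖p l‖ + (N + 1) * (Fintype.card L * γ₂) := by linarith [hz2, hcg, hkg2]
    have hpos2 : 0 ≤ (|1 - 2 * lam| + 2 * |lam| + 1) * (∑ l, ‖z.2 l‖ + Fintype.card L * ((|lam| + |1 - 2 * lam|) * (Dmax / κ))) +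
        4 * lam ^ 2 * (Fintype.card L * Dmax / κ) := by positivity
    have hc8 : (0 : ℝ) ≤ |1 - 2 * lam| + 2 * |lam| + 1 := by positivity
    have hC₀ : 0 ≤ β * K * ((Fintype.card n : ℝ) ^ 2 * Cι) * |δ| := by positivity
    have hX' : 0 ≤ ‖p‖ + (N + 1) * γ₂ := by positivity
    have hY : (|1 - 2 * lam| + 2 * |lam| + 1) * (∑ l, ‖z.2 l‖ + Fintype.card L * ((|lam| + |1 - 2 * lam|) * (Dmax / κ))) +
        4 * lam ^ 2 * (Fintype.card L * Dmax / κ) ≤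
        (|1 - 2 * lam| + 2 * |lam| + 1) * (∑ l, ‖p l‖ + (N + 1) * (Fintype.card L * γ₂)) + 4 * lam ^ 2 * (Fintype.card L * Dmax / κ) :=
      add_le_add (mul_le_mul_of_nonneg_left hs1 hc8) le_rfl
    refine hstep.trans ?_
    rw [hBd]
    exact mul_le_mul (mul_le_mul_of_nonneg_left hn1 hC₀) hY hpos2 (mul_nonneg hC₀ hX')
  -- telescope
  have tele : ∀ k, k ≤ N → |Hf (Ψ^[k] (q, p)) - Hf (q, p)| ≤ k * Bd := by
    intro k
    induction k with
    | zero => intro _; simp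
    | succ k ih =>
      intro hk
      have hk' : k ≤ N := Nat.le_of_succ_le hk
      rw [Function.iterate_succ_apply']
      calc |Hf (Ψ (Ψ^[k] (q, p))) - Hf (q, p)|
          ≤ |Hf (Ψ (Ψ^[k] (q, p))) - Hf (Ψ^[k] (q, p))| + |Hf (Ψ^[k] (q, p)) - Hf (q, p)| := abs_sub_le _ _ _
        _ ≤ Bd + k * Bd := add_le_add (hone k hk') (ih hk')
        _ = ((k + 1 : ℕ) : ℝ) * Bd := by push_cast; ring
  intro k hk
  exact tele k hk

set_option maxHeartbeats 400000 in -- RN-23 (7)(b): heavy declaration budgeted at source (lake build ≈ 10 % hungrier than the gate)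
/-- **THE ENERGY ERROR OF THE ENGINE'S `n`-STEP `SU(N)` OMF2 PROPOSAL** `flip ∘ (omf2Word g₁ (mulDrift e_δ) g₂)ⁿ` with the
consistent kicks — the quantity in the Metropolis test of the OMF2 kernel (exact on the `SU(N)` rung by `Omf2ProposalLaws` §0):
`|H(Ψ_n(q,p)) − H(q,p)| ≤ n·βK·A|δ|·(‖p‖ + (n+1)γ₂)·((|1−2λ|+2|λ|+1)·(Σ_l‖p_l‖ + (n+1)|L|γ₂) + 4λ²|L|D_max/κ)`,
`A = N²C_ι`, `γ₂ = (2|λ| + |1−2λ|)·D_max/κ` — `O(nδ²) = O(τδ)` at fixed trajectory length once `K, D_max = O(δ)`. -/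
theorem abs_sunOmf2ProposalN_energy_error_le {Cι : ℝ} (hC0 : 0 ≤ Cι) (hCι : ∀ x : E, ‖ι x‖ ≤ Cι * ‖x‖)
    (S : (L → Matrix.specialUnitaryGroup n ℂ) → ℝ) (δ κ lam : ℝ) (hκ : 0 < κ)
    (hd : ∀ W : L → Matrix.specialUnitaryGroup n ℂ, DifferentiableAt ℝ (fun a : L → E => S (sunExpDrift ι hι δ a * W)) 0)
    (hBs : ∀ x y : E, B x y = B y x) {β : ℝ} (hβ0 : 0 ≤ β) (hBβ : ∀ x y : E, |B x y| ≤ β * ‖x‖ * ‖y‖)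
    (D g₁ g₂ : (L → Matrix.specialUnitaryGroup n ℂ) → L → E)
    (hD : ∀ (W : L → Matrix.specialUnitaryGroup n ℂ) (v : L → E),
      fderiv ℝ (fun a : L → E => S (sunExpDrift ι hι δ a * W)) 0 v = ∑ l, B (D W l) (v l))
    {Dmax K : ℝ} (hD0 : 0 ≤ Dmax) (hK0 : 0 ≤ K)
    (hDb : ∀ (W : L → Matrix.specialUnitaryGroup n ℂ) (l : L), ‖D W l‖ ≤ Dmax)
    (hDK : ∀ W W' : L → Matrix.specialUnitaryGroup n ℂ, ‖D W - D W'‖ ≤ K * ‖coeConfig W - coeConfig W'‖)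
    (hg₁ : ∀ W l, g₁ W l = -(lam / κ) • D W l) (hg₂ : ∀ W l, g₂ W l = -((1 - 2 * lam) / κ) • D W l)
    (q : L → Matrix.specialUnitaryGroup n ℂ) (p : L → E) (N : ℕ) :
    |(S (((flip : Equiv.Perm ((L → Matrix.specialUnitaryGroup n ℂ) × (L → E))) *
          omf2Word g₁ (mulDrift (sunExpDrift ι hι δ)) g₂ ^ N) (q, p)).1 +
        κ * ∑ l, B ((((flip : Equiv.Perm ((L → Matrix.specialUnitaryGroup n ℂ) × (L → E))) *
            omf2Word g₁ (mulDrift (sunExpDrift ι hι δ)) g₂ ^ N) (q, p)).2 l)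
          ((((flip : Equiv.Perm ((L → Matrix.specialUnitaryGroup n ℂ) × (L → E))) *
            omf2Word g₁ (mulDrift (sunExpDrift ι hι δ)) g₂ ^ N) (q, p)).2 l)) -
      (S q + κ * ∑ l, B (p l) (p l))| ≤
      N * (β * K * ((Fintype.card n : ℝ) ^ 2 * Cι) * |δ| * (‖p‖ + (N + 1) * ((2 * |lam| + |1 - 2 * lam|) * (Dmax / κ))) *
        ((|1 - 2 * lam| + 2 * |lam| + 1) * (∑ l, ‖p l‖ + (N + 1) * (Fintype.card L * ((2 * |lam| + |1 - 2 * lam|) * (Dmax / κ)))) +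
          4 * lam ^ 2 * (Fintype.card L * Dmax / κ))) := by
  have h := abs_sunOmf2N_energy_error_le ι hι B hC0 hCι S δ κ lam hκ hd hBs hβ0 hBβ D g₁ g₂ hD hD0 hK0 hDb hDK hg₁ hg₂ q p N N le_rfl
  rw [Equiv.Perm.coe_mul, Function.comp_apply, flip_apply, Equiv.Perm.coe_pow]
  simp only [Pi.neg_apply, map_neg, LinearMap.neg_apply, neg_neg]
  exact h

end Summit.Ventures.LatticeQCDFlow.Exactness
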